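import Summits.BirchSwinnertonDyer.Rank1Residual.Additive.X4RankZeroCoveredLocus
import Summits.BirchSwinnertonDyer.Rank1Residual.Additive.X4RankZeroKatoParity
import Summits.BirchSwinnertonDyer.Rank1Residual.Additive.X4SharpThreeResidue
import HarnessLib

/-!
# X4♯(unit-free) and X4♯ REDUCED TO THEIR RESIDUES AT EVERY ODD PRIME — the end-state map of the
# additive irreducible class X4 as ONE kernel statement
# (cell `b2b-bsdres`, seat additive-p4, line V22 part 2; part 1 = `Additive/X4RankZeroCoveredLocus.lean`,
# `p = 3` sibling = `Additive/X4SharpThreeResidue.lean`)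

HONEST FRAMING (cell `b2b-bsdres`, run/shared/lean/b2b/bsd-rank1-residual/, verbatim in every
file): the goal of the cell is to DELETE the COMBINATION-SHAPED residual classes of the
Birch–Swinnerton-Dyer formula for ALL analytic-rank `≤ 1` elliptic curves over `ℚ` — "full BSD
formula for every rank `≤ 1` curve in class `C`" assembled STRICTLY from published theorems — so
that the rank-`≤ 1` remainder becomes exactly the CONSTRUCTION-SHAPED classes, which are TYPED
(missing-input `Prop`s), NOT attempted. This is not "finishing BSD". Sub-cell additive-p4 (X3♯/X4♯
direct): research route on the CONSTRUCTION-SHAPED class X4; no claim beyond the stated classes;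
the label X4 is UNCHANGED by this file; nothing is booked. Theorems only (no definition, no named
fact minted; every published input is an explicit named-fact hypothesis of the tree).

## What this file proves

Granted the five named facts of part 1 (sharp Kato reading A161 `hKatoS`; Delbourgo 1998 Prop. 4
`hDel`; modular parametrisation data `hmodD`; Wuthrich 2014 Lemma 20 `hL20`; Kato's half-eigen
divisibility over `ℚ(μ_{p^∞})` `hKatoχ`) + GZK + modularity:

* §3 **`x4SharpUnitFree_iff_lower_and_upperResidue`**: the sharpened conjecture X4♯(unit-free)
  (`Additive.X4SharpUnitFree`: `r_an = 0`, odd additive `p`, `E[p]` irreducible, `ρ̄_{E,p}` onto ⟹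
  `ord_p #Ш = ord_p #Ш_an`) is EQUIVALENT to LOWER ∧ UPPER-RESIDUE, where LOWER = the lower half
  `ord_p #Ш_an ≤ ord_p #Ш` on EVERY X4 ∧ `r_an = 0` ∧ surj(p) pair (the Skinner–Urban direction: an
  IMC equality at an additive prime / on a tame branch `ω^i`, `i ≠ 0` — printed nowhere; vacuous
  on the `p ∤ #Ш_an` rows) and UPPER-RESIDUE = the upper half on the potentially good such pairs
  failing the certificate triple [tower ∧ `ord_p ∏ c_ℓ = ord_p c_p` ∧ Manin datum]; split form
  **`x4SharpUnitFree_iff_lower_and_residues`**: UPPER-RESIDUE = EXOTIC (`p = 3`, `ord₃ j ≥ 0`,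
  `ρ̄_{E,3^n}` not onto for some `n`; by Serre only `p = 3` can fail the tower) ∪ TAM-DEFECT
  (`ord_p ∏ c_ℓ ≠ ord_p c_p`, i.e. some `c_ℓ`, `ℓ ≠ p`, divisible by `p`: Kim's Conjecture 1.10 /
  Castella–Sano "IMC-det", PRE) ∪ MANIN (no parametrisation datum with `p ∤ c_D`).
* §3b **`x4SharpUnitFree_iff_lower_and_residues_of_casselsTate`**: with Cassels' theorem (`#Ш` a
  square; `hCT` = bsd.S18) as a sixth input, the TAM-DEFECT piece shrinks to TAM-DEFECT₂
  (`ord_p ∏ c_ℓ ≥ v_p(c_p) + 2`) plus the (census-empty) ODD-SHA piece (`ord_p #Ш_an` odd): the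
  Tamagawa-defect-ONE rows are covered by parity (`X4RankZeroKatoParity`, line V23 — at `p = 3`
  127 ‖ 29 of the 136 ‖ 30 N11 Tamagawa-defect window rows, 16 383 of 18 416 sweep rows).
* §4 the same for the full class conjecture **X4♯** (`x4Sharp_iff_unitFree_and_rankOne_and_nonSurj`,
  **`x4Sharp_iff_residues`**): X4♯ ⟺ LOWER ∧ EXOTIC ∧ TAM-DEFECT ∧ MANIN ∧ X4♯(r = 1) ∧ NON-SURJ
  — what no published theorem reaches, as one kernel statement (the human's partition question
  one level down, for class X4).
* §5 registry note made kernel-explicit: the V20 fact A154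
  (`Kato2004.rankZero_padicValNat_sha_le_of_additive_potGood_of_imageContainsSL2`) has no binder of
  record left — the V21 census shape follows from A161 (`…_of_cert_of_shaAn_unit_ofSharp`).

Census of the residue pieces (seat; numbers of record in HOME/b2b-bsdres-additive-p4/V22-*.tsv and
README §17, not in this docstring). X4 stays CONSTRUCTION-SHAPED: LOWER, EXOTIC, TAM-DEFECT,
MANIN, rank 1 and the non-surjective rows are exactly what no published theorem reaches; per pair
they are certificate territory (3-descent / Kolyvagin index `X4/KolyvaginSqueeze.lean`; mod-9 image;
Cremona optimality + Agashe–Ribet–Stein 2006). Nothing booked.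

References: Kato 2004 [Kato2004Asterisque] Thm. 14.5 (3), Prop. 14.16 (2), Thm. 17.4 (3), (12.5.2);
Kim 2026 [Kim2022StructureSelmer] Thm. 1.9 (6), Conj. 1.10; Delbourgo 1998 [Delbourgo1998] Prop. 4;
Wuthrich 2014 [Wuthrich2014] Lemma 20, Cor. 19; Serre 1972 [Serre1972] IV §3.4; Miller 2011
[Miller2011LMS] Def. 1.1; SHARPENED-CONJECTURES.md §4; RESIDUAL-MAP §I N11.
-/

noncomputable section

open scoped Classical

open WeierstrassCurve Literature.NumberTheory.EllipticCurves
  Literature.NumberTheory.EllipticCurves.ModularForms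
  Literature.NumberTheory.EllipticCurves.Rank1Residual
  Literature.NumberTheory.EllipticCurves.Rank1Residual.Typed

namespace Summit.BirchSwinnertonDyer.Rank1Residual.Additive

variable (W : WeierstrassCurve ℚ) [W.IsElliptic] [W.IsGloballyMinimal] (p : ℕ) [hp : Fact p.Prime]

/-! ### §3 THE REDUCTION of X4♯(unit-free) to its residues -/

/-- **X4♯(unit-free) ⟺ LOWER ∧ UPPER-RESIDUE** (granted the five named facts + GZK + modularity):
the conjecture is EQUIVALENT to the conjunction of (LOWER) the lower half `ord_p #Ш_an ≤ ord_p #Ш` on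
EVERY X4 ∧ `r_an = 0` ∧ surj(p) pair, and (UPPER-RESIDUE) the upper half `ord_p #Ш ≤ ord_p #Ш_an`
on the potentially good such pairs which FAIL the certificate triple [tower surjectivity ∧
`ord_p ∏ c_ℓ = ord_p c_p` ∧ a Manin datum prime to `p`]. Everything else of X4♯(unit-free) is a
theorem of the published record. [cite: Kato2004Asterisque, Thm. 14.5 (3) (p. 236), Thm. 17.4 (3) (p. 273)]
[cite: Delbourgo1998, Prop. 4 (p. 144)] [cite: Wuthrich2014, Lemma 20 (p. 399), Cor. 19 (p. 398)]
[cite: Kim2022StructureSelmer, Conj. 1.10 (PDF p. 8)] [cite: Miller2011LMS, Def. 1.1] -/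
theorem x4SharpUnitFree_iff_lower_and_upperResidue
    (hKatoS : Kato2004.rankZero_padicValNat_sha_le_sub_localTamagawa_of_additive_potGood_of_imageContainsSL2)
    (hDel : Delbourgo1998.prop4_rankZero_pow_dvd_constantCoeff)
    (hGZK : rank_eq_analyticRank_of_analyticRank_le_one) (hmod : hasEntireLFunction_rat)
    (hmodD : nonempty_modularParametrizationData)
    (hL20 : Wuthrich2014.lemma20_surjective_threeAdic_of_semistable)
    (hKatoχ : Wuthrich2014.kato_halfEigenCharIdeal_dvd_cyclotomicPrime_of_surjective) :
    X4SharpUnitFree ↔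
      (∀ (W : WeierstrassCurve ℚ) [W.IsElliptic] [W.IsGloballyMinimal] (p : ℕ) [Fact p.Prime],
          W.analyticRank = 0 → ClassX4 W p → Surj W p → MissingLowerBoundAt W p) ∧
      (∀ (W : WeierstrassCurve ℚ) [W.IsElliptic] [W.IsGloballyMinimal] (p : ℕ) [Fact p.Prime],
          W.analyticRank = 0 → ClassX4 W p → Surj W p → 0 ≤ padicValRat p W.j →
          ¬ ((∀ n : ℕ, W.HasSurjectiveModNGaloisRep (p ^ n : ℕ)) ∧
              padicValNat p W.tamagawaProduct =
                padicValNat p ((W.baseChange ℚ_[p]).localTamagawaNumber ℤ_[p]) ∧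
              ∃ (N : ℕ) (_ : NeZero N) (D : ModularParametrizationData W N),
                ¬ (p : ℤ) ∣ D.maninConstant) →
          MissingUpperBoundAt W p) := by
  constructor
  · intro h
    exact ⟨fun V _ _ p _ hr hX hs ↦ (lower_and_upper_of_missingPPartAt V p (h V p hr hX hs)).1,
      fun V _ _ p _ hr hX hs _ _ ↦ (lower_and_upper_of_missingPPartAt V p (h V p hr hX hs)).2⟩
  · rintro ⟨hlow, hres⟩ V _ _ p _ hr hX hs
    refine missingPPartAt_of_lower_of_upper V p (hlow V p hr hX hs) ?_
    by_cases hj : padicValRat p V.j < 0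
    · exact X4RankZero.missingUpperBoundAt_of_facts V p hKatoS hDel hGZK hmod hmodD hL20 hKatoχ hr hX
        hs (Or.inl hj)
    · by_cases hcert : (∀ n : ℕ, V.HasSurjectiveModNGaloisRep (p ^ n : ℕ)) ∧
          padicValNat p V.tamagawaProduct =
            padicValNat p ((V.baseChange ℚ_[p]).localTamagawaNumber ℤ_[p]) ∧
          ∃ (N : ℕ) (_ : NeZero N) (D : ModularParametrizationData V N), ¬ (p : ℤ) ∣ D.maninConstant
      · exact X4RankZero.missingUpperBoundAt_of_facts V p hKatoS hDel hGZK hmod hmodD hL20 hKatoχ hr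
          hX hs (Or.inr hcert)
      · exact hres V p hr hX hs (not_lt.mp hj) hcert

/-- **X4♯(unit-free) ⟺ LOWER ∧ EXOTIC ∧ TAM-DEFECT ∧ MANIN** — the upper residue split into its
three census pieces: EXOTIC = `p = 3`, `ord₃ j ≥ 0`, `ρ̄_{E,3^n}` not onto for some `n` (by Serre the
tower can fail only at `p = 3`; census: the 20 S-b curves with `j ∈ {15786448344, 4374, −44789760}`,
N < 5·10⁵); TAM-DEFECT = `ord_p j ≥ 0`, `ord_p ∏ c_ℓ ≠ ord_p c_p` (some `c_ℓ`, `ℓ ≠ p`, divisible by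
`p`: Kim's Conjecture 1.10, Castella–Sano arXiv:2601.14504 "IMC-det", PRE); MANIN = `ord_p j ≥ 0`,
no modular parametrisation datum with Manin constant prime to `p`. The pieces overlap; each is
stated with the other two certificates granted where that sharpens it (EXOTIC and TAM-DEFECT
unconditionally in the other bits, MANIN likewise). [cite: Kato2004Asterisque, Thm. 14.5 (3) (p. 236), Thm. 17.4 (3) (p. 273)]
[cite: Delbourgo1998, Prop. 4 (p. 144)] [cite: Serre1972, IV §3.4] [cite: Kim2022StructureSelmer, Conj. 1.10 (PDF p. 8)]
[cite: Miller2011LMS, Def. 1.1] -/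
theorem x4SharpUnitFree_iff_lower_and_residues
    (hKatoS : Kato2004.rankZero_padicValNat_sha_le_sub_localTamagawa_of_additive_potGood_of_imageContainsSL2)
    (hDel : Delbourgo1998.prop4_rankZero_pow_dvd_constantCoeff)
    (hGZK : rank_eq_analyticRank_of_analyticRank_le_one) (hmod : hasEntireLFunction_rat)
    (hmodD : nonempty_modularParametrizationData)
    (hL20 : Wuthrich2014.lemma20_surjective_threeAdic_of_semistable)
    (hKatoχ : Wuthrich2014.kato_halfEigenCharIdeal_dvd_cyclotomicPrime_of_surjective) :
    X4SharpUnitFree ↔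
      (∀ (W : WeierstrassCurve ℚ) [W.IsElliptic] [W.IsGloballyMinimal] (p : ℕ) [Fact p.Prime],
          W.analyticRank = 0 → ClassX4 W p → Surj W p → MissingLowerBoundAt W p) ∧
      (∀ (W : WeierstrassCurve ℚ) [W.IsElliptic] [W.IsGloballyMinimal],
          W.analyticRank = 0 → ClassX4 W 3 → Surj W 3 → 0 ≤ padicValRat 3 W.j →
          ¬ (∀ n : ℕ, W.HasSurjectiveModNGaloisRep (3 ^ n : ℕ)) → MissingUpperBoundAt W 3) ∧
      (∀ (W : WeierstrassCurve ℚ) [W.IsElliptic] [W.IsGloballyMinimal] (p : ℕ) [Fact p.Prime],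
          W.analyticRank = 0 → ClassX4 W p → Surj W p → 0 ≤ padicValRat p W.j →
          padicValNat p W.tamagawaProduct ≠
            padicValNat p ((W.baseChange ℚ_[p]).localTamagawaNumber ℤ_[p]) →
          MissingUpperBoundAt W p) ∧
      (∀ (W : WeierstrassCurve ℚ) [W.IsElliptic] [W.IsGloballyMinimal] (p : ℕ) [Fact p.Prime],
          W.analyticRank = 0 → ClassX4 W p → Surj W p → 0 ≤ padicValRat p W.j →
          (∀ (N : ℕ) [NeZero N] (D : ModularParametrizationData W N), (p : ℤ) ∣ D.maninConstant) →
          MissingUpperBoundAt W p) := by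
  rw [x4SharpUnitFree_iff_lower_and_upperResidue hKatoS hDel hGZK hmod hmodD hL20 hKatoχ]
  refine and_congr_right fun _ ↦ ⟨fun hres ↦ ⟨?_, ?_, ?_⟩, ?_⟩
  · intro V _ _ hr hX hs hj htower
    exact hres V 3 hr hX hs hj fun h ↦ htower h.1
  · intro V _ _ p _ hr hX hs hj htam
    exact hres V p hr hX hs hj fun h ↦ htam h.2.1
  · intro V _ _ p _ hr hX hs hj hnoD
    exact hres V p hr hX hs hj fun ⟨_, _, N, hN, D, hc⟩ ↦ by
      haveI := hN
      exact hc (hnoD N D)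
  · rintro ⟨hexotic, htamDefect, hmanin⟩ V _ _ p hpi hr hX hs hj hcert
    by_cases htower : ∀ n : ℕ, V.HasSurjectiveModNGaloisRep (p ^ n : ℕ)
    · by_cases htam : padicValNat p V.tamagawaProduct =
          padicValNat p ((V.baseChange ℚ_[p]).localTamagawaNumber ℤ_[p])
      · by_cases hD : ∃ (N : ℕ) (_ : NeZero N) (D : ModularParametrizationData V N),
            ¬ (p : ℤ) ∣ D.maninConstant
        · exact absurd ⟨htower, htam, hD⟩ hcert
        · refine hmanin V p hr hX hs hj fun N _ D ↦ ?_
          by_contra hc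
          exact hD ⟨N, inferInstance, D, hc⟩
      · exact htamDefect V p hr hX hs hj htam
    · -- the tower fails: by Serre this forces `p = 3`
      rcases eq_three_or_five_le_of_classX4 V p hX with h3 | h5
      · subst h3
        exact hexotic V hr hX hs hj htower
      · exact absurd (serre_hasSurjectiveModNGaloisRep_pow_holds V p h5 hs) htower

/-! ### §3b The reduction with Cassels–Tate parity: TAM-DEFECT shrinks to TAM-DEFECT₂ -/

/-- **X4♯(unit-free) ⟺ LOWER ∧ EXOTIC ∧ TAM-DEFECT₂ ∧ ODD-SHA ∧ MANIN** (granted the five named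
facts + Cassels–Tate `hCT` + GZK + modularity): with `#Ш` a perfect square, the Tamagawa-defect-ONE
rows (`ord_p ∏ c_ℓ = v_p(c_p) + 1`) whose `ord_p #Ш_an` is even are COVERED
(`X4RankZero.missingUpperBoundAt_of_katoSharp_of_casselsTate_of_tamDefect_le_one_of_even`), so the
upper residue is EXOTIC ∪ TAM-DEFECT₂ (`ord_p ∏ c_ℓ ≥ v_p(c_p) + 2`: `ord_p #Ш ∈ {0, 2, …}` undecided)
∪ ODD-SHA (`#Ш_an = q` with `ord_p q` odd — empty in every census: all tabulated `#Ш_an` are squares;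
X4♯ together with Cassels–Tate predicts it is empty) ∪ MANIN.
[cite: Kato2004Asterisque, Thm. 14.5 (3) (p. 236), Thm. 17.4 (3) (p. 273)] [cite: SilvermanAEC2009, Thm. X.4.14]
[cite: Delbourgo1998, Prop. 4 (p. 144)] [cite: Kim2022StructureSelmer, Conj. 1.10 (PDF p. 8)]
[cite: Miller2011LMS, Def. 1.1] -/
theorem x4SharpUnitFree_iff_lower_and_residues_of_casselsTate
    (hCT : exists_casselsTate_pairing (K := ℚ))
    (hKatoS : Kato2004.rankZero_padicValNat_sha_le_sub_localTamagawa_of_additive_potGood_of_imageContainsSL2)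
    (hDel : Delbourgo1998.prop4_rankZero_pow_dvd_constantCoeff)
    (hGZK : rank_eq_analyticRank_of_analyticRank_le_one) (hmod : hasEntireLFunction_rat)
    (hmodD : nonempty_modularParametrizationData)
    (hL20 : Wuthrich2014.lemma20_surjective_threeAdic_of_semistable)
    (hKatoχ : Wuthrich2014.kato_halfEigenCharIdeal_dvd_cyclotomicPrime_of_surjective) :
    X4SharpUnitFree ↔
      (∀ (W : WeierstrassCurve ℚ) [W.IsElliptic] [W.IsGloballyMinimal] (p : ℕ) [Fact p.Prime],
          W.analyticRank = 0 → ClassX4 W p → Surj W p → MissingLowerBoundAt W p) ∧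
      (∀ (W : WeierstrassCurve ℚ) [W.IsElliptic] [W.IsGloballyMinimal],
          W.analyticRank = 0 → ClassX4 W 3 → Surj W 3 → 0 ≤ padicValRat 3 W.j →
          ¬ (∀ n : ℕ, W.HasSurjectiveModNGaloisRep (3 ^ n : ℕ)) → MissingUpperBoundAt W 3) ∧
      (∀ (W : WeierstrassCurve ℚ) [W.IsElliptic] [W.IsGloballyMinimal] (p : ℕ) [Fact p.Prime],
          W.analyticRank = 0 → ClassX4 W p → Surj W p → 0 ≤ padicValRat p W.j →
          padicValNat p ((W.baseChange ℚ_[p]).localTamagawaNumber ℤ_[p]) + 2 ≤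
            padicValNat p W.tamagawaProduct →
          MissingUpperBoundAt W p) ∧
      (∀ (W : WeierstrassCurve ℚ) [W.IsElliptic] [W.IsGloballyMinimal] (p : ℕ) [Fact p.Prime],
          W.analyticRank = 0 → ClassX4 W p → Surj W p → 0 ≤ padicValRat p W.j →
          (∃ q : ℚ, shaAn W = (q : ℂ) ∧ Odd (padicValRat p q)) → MissingUpperBoundAt W p) ∧
      (∀ (W : WeierstrassCurve ℚ) [W.IsElliptic] [W.IsGloballyMinimal] (p : ℕ) [Fact p.Prime],
          W.analyticRank = 0 → ClassX4 W p → Surj W p → 0 ≤ padicValRat p W.j →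
          (∀ (N : ℕ) [NeZero N] (D : ModularParametrizationData W N), (p : ℤ) ∣ D.maninConstant) →
          MissingUpperBoundAt W p) := by
  rw [x4SharpUnitFree_iff_lower_and_residues hKatoS hDel hGZK hmod hmodD hL20 hKatoχ]
  refine and_congr_right fun _ ↦ and_congr_right fun hexotic ↦ ⟨fun ⟨htam, hmanin⟩ ↦ ⟨?_, ?_, hmanin⟩, ?_⟩
  · intro V _ _ p _ hr hX hs hj h2
    exact htam V p hr hX hs hj (by omega)
  · intro V _ _ p _ hr hX hs hj ⟨q, hq, hodd⟩
    -- an odd `ord_p #Ш_an` row: either some certificate fails (then a residue piece of the coarser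
    -- split applies) or the parity-sharpened bound is what X4♯ asks; we only need the coarse pieces
    by_cases htamEq : padicValNat p V.tamagawaProduct =
        padicValNat p ((V.baseChange ℚ_[p]).localTamagawaNumber ℤ_[p])
    · by_cases htower : ∀ n : ℕ, V.HasSurjectiveModNGaloisRep (p ^ n : ℕ)
      · by_cases hD : ∃ (N : ℕ) (_ : NeZero N) (D : ModularParametrizationData V N),
            ¬ (p : ℤ) ∣ D.maninConstant
        · obtain ⟨N, hN, D, hc⟩ := hD
          haveI := hN
          exact X4RankZero.missingUpperBoundAt_of_katoSharp V p hKatoS hGZK hmod hr hX hj htower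
            htamEq D hc
        · refine hmanin V p hr hX hs hj fun N _ D ↦ ?_
          by_contra hc
          exact hD ⟨N, inferInstance, D, hc⟩
      · rcases eq_three_or_five_le_of_classX4 V p hX with h3 | h5
        · subst h3
          exact hexotic V hr hX hs hj htower
        · exact absurd (serre_hasSurjectiveModNGaloisRep_pow_holds V p h5 hs) htower
    · exact htam V p hr hX hs hj htamEq
  · rintro ⟨htam2, hoddSha, hmanin⟩
    refine ⟨?_, hmanin⟩
    intro V _ _ p _ hr hX hs hj htamNe
    by_cases htower : ∀ n : ℕ, V.HasSurjectiveModNGaloisRep (p ^ n : ℕ)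
    · by_cases hD : ∃ (N : ℕ) (_ : NeZero N) (D : ModularParametrizationData V N),
          ¬ (p : ℤ) ∣ D.maninConstant
      · obtain ⟨N, hN, D, hc⟩ := hD
        haveI := hN
        -- the sharp bound exists; split on the size of the Tamagawa defect and the parity of `ord_p #Ш_an`
        obtain ⟨q, hq, hle⟩ :=
          X4RankZero.padicValNat_shaOrder_le_of_katoSharp V p hKatoS hGZK hmod hr hX hj htower D hc
        by_cases h1 : padicValNat p V.tamagawaProduct ≤
            padicValNat p ((V.baseChange ℚ_[p]).localTamagawaNumber ℤ_[p]) + 1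
        · rcases Int.even_or_odd (padicValRat p q) with heven | hodd
          · exact X4RankZero.missingUpperBoundAt_of_katoSharp_of_casselsTate_of_tamDefect_le_one_of_even
              V p hCT hKatoS hGZK hmod hr hX hj htower D hc h1 hq heven
          · exact hoddSha V p hr hX hs hj ⟨q, hq, hodd⟩
        · exact htam2 V p hr hX hs hj (by omega)
      · refine hmanin V p hr hX hs hj fun N _ D ↦ ?_
        by_contra hc
        exact hD ⟨N, inferInstance, D, hc⟩
    · rcases eq_three_or_five_le_of_classX4 V p hX with h3 | h5
      · subst h3
        exact hexotic V hr hX hs hj htower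
      · exact absurd (serre_hasSurjectiveModNGaloisRep_pow_holds V p h5 hs) htower

/-! ### §4 The full class conjecture X4♯ -/

/-- **X4♯ ⟺ X4♯(unit-free) ∧ X4♯(r = 1) ∧ NON-SURJ** — the class-wide conjecture split by the
image of `ρ̄_{E,p}` and the analytic rank (`x4Sharp_surj_iff` of `SharpenedStatements`), with the
non-surjective irreducible rows (census 96 ‖ 49, images 3Nn/3Ns/5Ns/5Nn/5S4/7Ns; no printed
statement) as their own conjunct. Bookkeeping. [folklore] -/
theorem x4Sharp_iff_unitFree_and_rankOne_and_nonSurj :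
    X4Sharp ↔ X4SharpUnitFree ∧ X4SharpRankOne ∧
      (∀ (W : WeierstrassCurve ℚ) [W.IsElliptic] [W.IsGloballyMinimal] (p : ℕ) [Fact p.Prime],
          W.analyticRank ≤ 1 → ClassX4 W p → ¬ Surj W p → MissingPPartAt W p) := by
  constructor
  · intro h
    obtain ⟨h0, h1⟩ := x4SharpUnitFree_and_rankOne_of_x4Sharp h
    exact ⟨h0, h1, fun V _ _ p _ hr hX _ ↦ h V p hr hX⟩
  · rintro ⟨h0, h1, hns⟩ V _ _ p _ hr hX
    by_cases hs : Surj V p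
    · exact x4Sharp_surj_iff.mpr ⟨h0, h1⟩ V p hr hX hs
    · exact hns V p hr hX hs

/-- **X4♯ ⟺ LOWER ∧ EXOTIC ∧ TAM-DEFECT ∧ MANIN ∧ X4♯(r = 1) ∧ NON-SURJ** — the end-state map of
class X4 as ONE kernel statement (granted the five named facts + GZK + modularity): what no
published theorem reaches is exactly (rank 0, surjective) the lower half everywhere and the upper
half on the exotic-`3`-adic / Tamagawa-defect / Manin-less potentially good rows, (rank 1) all of
X4♯(r = 1), and the non-surjective rows. [cite: Kato2004Asterisque, Thm. 14.5 (3) (p. 236), Thm. 17.4 (3) (p. 273)]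
[cite: Delbourgo1998, Prop. 4 (p. 144)] [cite: Wuthrich2014, Lemma 20 (p. 399), Cor. 19 (p. 398)]
[cite: Kim2022StructureSelmer, Conj. 1.10 (PDF p. 8)] [cite: Miller2011LMS, Def. 1.1] -/
theorem x4Sharp_iff_residues
    (hKatoS : Kato2004.rankZero_padicValNat_sha_le_sub_localTamagawa_of_additive_potGood_of_imageContainsSL2)
    (hDel : Delbourgo1998.prop4_rankZero_pow_dvd_constantCoeff)
    (hGZK : rank_eq_analyticRank_of_analyticRank_le_one) (hmod : hasEntireLFunction_rat)
    (hmodD : nonempty_modularParametrizationData)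
    (hL20 : Wuthrich2014.lemma20_surjective_threeAdic_of_semistable)
    (hKatoχ : Wuthrich2014.kato_halfEigenCharIdeal_dvd_cyclotomicPrime_of_surjective) :
    X4Sharp ↔
      ((∀ (W : WeierstrassCurve ℚ) [W.IsElliptic] [W.IsGloballyMinimal] (p : ℕ) [Fact p.Prime],
          W.analyticRank = 0 → ClassX4 W p → Surj W p → MissingLowerBoundAt W p) ∧
       (∀ (W : WeierstrassCurve ℚ) [W.IsElliptic] [W.IsGloballyMinimal],
          W.analyticRank = 0 → ClassX4 W 3 → Surj W 3 → 0 ≤ padicValRat 3 W.j →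
          ¬ (∀ n : ℕ, W.HasSurjectiveModNGaloisRep (3 ^ n : ℕ)) → MissingUpperBoundAt W 3) ∧
       (∀ (W : WeierstrassCurve ℚ) [W.IsElliptic] [W.IsGloballyMinimal] (p : ℕ) [Fact p.Prime],
          W.analyticRank = 0 → ClassX4 W p → Surj W p → 0 ≤ padicValRat p W.j →
          padicValNat p W.tamagawaProduct ≠
            padicValNat p ((W.baseChange ℚ_[p]).localTamagawaNumber ℤ_[p]) →
          MissingUpperBoundAt W p) ∧
       (∀ (W : WeierstrassCurve ℚ) [W.IsElliptic] [W.IsGloballyMinimal] (p : ℕ) [Fact p.Prime],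
          W.analyticRank = 0 → ClassX4 W p → Surj W p → 0 ≤ padicValRat p W.j →
          (∀ (N : ℕ) [NeZero N] (D : ModularParametrizationData W N), (p : ℤ) ∣ D.maninConstant) →
          MissingUpperBoundAt W p)) ∧
      X4SharpRankOne ∧
      (∀ (W : WeierstrassCurve ℚ) [W.IsElliptic] [W.IsGloballyMinimal] (p : ℕ) [Fact p.Prime],
          W.analyticRank ≤ 1 → ClassX4 W p → ¬ Surj W p → MissingPPartAt W p) := by
  rw [x4Sharp_iff_unitFree_and_rankOne_and_nonSurj,
    x4SharpUnitFree_iff_lower_and_residues hKatoS hDel hGZK hmod hmodD hL20 hKatoχ]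

/-! ### §5 The V20 fact A154 has no binder of record left (registry note, kernel-explicit) -/

/-- **A154 ⟸ A161 at the consumer level**: the V21 census shape
`X4RankZero.bsdp_three_of_cert_of_shaAn_unit` (binder: the V20 reading A154
`Kato2004.rankZero_padicValNat_sha_le_of_additive_potGood_of_imageContainsSL2`, with `3 ∤ ∏ c_ℓ`)
from the SHARP reading A161 alone, through the Literature bridge
`Kato2004.rankZero_padicValNat_sha_le_of_additive_potGood_of_imageContainsSL2_of_sharp`. Every
other A154 consumer is an instance of the same substitution, so A154 is retirable (the registry's
call). [cite: Kato2004Asterisque, Thm. 14.5 (3) (p. 236), Prop. 14.16 (2) (p. 244)]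
[cite: Delbourgo1998, Prop. 4 (p. 144)] [cite: Miller2011LMS, §1 and Def. 1.1] -/
theorem X4RankZero.bsdp_three_of_cert_of_shaAn_unit_ofSharp
    (hKatoS : Kato2004.rankZero_padicValNat_sha_le_sub_localTamagawa_of_additive_potGood_of_imageContainsSL2)
    (hDel : Delbourgo1998.prop4_rankZero_pow_dvd_constantCoeff)
    (hGZK : rank_eq_analyticRank_of_analyticRank_le_one) (hmod : hasEntireLFunction_rat)
    (hmodD : nonempty_modularParametrizationData)
    (hL20 : Wuthrich2014.lemma20_surjective_threeAdic_of_semistable)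
    (hKatoω : Wuthrich2014.kato_minusEigenCharIdeal_dvd_cyclotomicThree_of_surjective)
    (hr : W.analyticRank = 0) (hX : ClassX4 W 3) (hsurj : Surj W 3)
    (hcert : padicValRat 3 W.j < 0 ∨
      (∃ q : ℕ, q.Prime ∧ q ≠ 3 ∧ padicValRat q W.j < 0 ∧ ¬ (3 : ℤ) ∣ padicValRat q W.j) ∨
        W.HasSurjectiveModNGaloisRep 9)
    (htam : ¬ 3 ∣ W.tamagawaProduct)
    {N : ℕ} [NeZero N] (D : ModularParametrizationData W N) (hc : ¬ (3 : ℤ) ∣ D.maninConstant)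
    {q : ℚ} (hq : shaAn W = (q : ℂ)) (hv : padicValRat 3 q = 0) : BSDp W 3 :=
  X4RankZero.bsdp_three_of_cert_of_shaAn_unit W
    (Kato2004.rankZero_padicValNat_sha_le_of_additive_potGood_of_imageContainsSL2_of_sharp hKatoS)
    hDel hGZK hmod hmodD hL20 hKatoω hr hX hsurj hcert htam D hc hq hv

end Summit.BirchSwinnertonDyer.Rank1Residual.Additive

end
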